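import Literature.NumberTheory.LFunctions.BurnolClosureCriterionProofs
import HarnessLib

/-!
# Burnol 2001, towards Thm 2.4 (`RH ⟹ span{U(λ)A} dense`): periodizations as superpositions of dilates of `A`

LABEL (line 1): RH-FREE identities (no hypothesis, no conclusion about RH). Stage 1 of the
`RH ⟹ density` half of the RH-EQUIVALENT·PRINTED criterion `Burnol2001_thm_2_4` (its `⟸` half is
the tree theorem `Burnol2001_thm_2_4_mpr`, p436464). bears_on: LADDER-RH B-C/B-P (COLUMN 6 DBR).
WHAT THIS IS NOT: nothing here bears on the truth of RH.

Burnol [Burnol2001, §2, TeX l.420–437 and Thm 2.4]: `A(u) = [1/u] log u + log([1/u]!) + [1/u]`,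
"the function `A(u)` … its Mellin transform is `((s−1)/s²)ζ(s)`", and the dilates `U(λ)A`,
`0 < λ ≤ 1`, should span `L²(0,1)` under RH (via the outer factor of `(s−1)ζ(s)/s²`, Beurling–Lax).
ELEMENTARY ROAD (deviation, as in `BurnolClosureCriterionProofs`): under RH every `g ∈ L²(0,1)`
is an `L²`-limit of periodizations `T(ψ)`, `ψ ∈ 𝒮⁰_{≤1}` (`Burnol2001.approxT_memLp`); this file
proves that every such `T(ψ)` is an EXACT continuous superposition of the dilates `u ↦ A(u/t)`:

* `Burnol2001.fnA_eq_sum`: `A(v) = Σ_{n ≤ 1/v} (1 + log(nv))`, i.e. `A = T(a)` with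
  `a = (1 + log x)𝟙_{(0,1]}` (whose Mellin transform is `1/s − 1/s² = (s−1)/s²`);
* `Burnol2001.IsTest0.eq_neg_integral_deriv_tilde_mul`: the one-variable identity
  `ψ(x) = −∫_x^1 φ̃′(t)(1 + log x − log t) dt` (`0 < x ≤ 1`), `φ̃ = ψ̃ − H(ψ̃)` the `𝒮_{≤1}`
  function of `BurnolClosureCriterionProofs` (integration by parts and
  `∫_x^1 φ̃(t)dt/t = −H(ψ)(x)`);
* `Burnol2001.IsTest0.mapT_eq_neg_integral_deriv_tilde_mul_fnA`: summing over the lattice,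
  **`T(ψ)(u) = −∫_0^1 φ̃′(t) A(u/t) dt`** for `0 < u ≤ 1`.

Stage 2 (UPDATE, appended below in the same file): Riemann sums in `t` and the
`L²`-continuity of `t ↦ A(·/t)` turn the superposition into finite combinations `Σ c_i U(λ_i)A`:
`Burnol2001.eLpNorm_intervalIntegral_le` (Cauchy–Schwarz in `t` + Tonelli),
`Burnol2001.dilate_fnA_uniform` (density of `C_c` in `L²`), and
`Burnol2001.dilate_fnA_closure_of_riemannHypothesis`; with the tree theorem
`riemannHypothesis_of_dilate_fnA_closure` this DISCHARGES **`Burnol2001_thm_2_4_holds`**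
(RH-EQUIVALENT·PRINTED criterion proved AS AN EQUIVALENCE; neither side asserted; nothing here
bears on the truth of RH). No definitions, no named facts (net debt −1).

## References
* [Burnol2001] J.-F. Burnol, *An adelic causality problem related to abelian L-functions*,
  J. Number Theory 87 (2001) 253–269 = arXiv:math/0001013v3, §2 (the function `A`, Thm 2.4).
-/

noncomputable section

open Complex Filter MeasureTheory Set intervalIntegral
open scoped Real Topology ContDiff

namespace Literature.NumberTheory.LFunctions

namespace Burnol2001

/-! ## `A` as a lattice sum -/

/-- `log N! = Σ_{n<N} log(n+1)`. [folklore] -/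
private theorem log_factorial_eq_sum (N : ℕ) :
    Real.log ((N.factorial : ℕ) : ℝ) = ∑ n ∈ Finset.range N, Real.log ((n + 1 : ℕ) : ℝ) := by
  induction N with
  | zero => simp
  | succ N ih =>
    rw [Nat.factorial_succ, Nat.cast_mul, Real.log_mul (by positivity) (by positivity), ih,
      Finset.sum_range_succ, add_comm]

/-- **`A = T(a)`**, `a(x) = (1 + log x)𝟙_{(0,1]}`: for `v > 0`,
`A(v) = Σ_{n < [1/v]} (1 + log((n+1)v))`. [cite: Burnol2001, §2 (before Thm 2.4), TeX l.420–437] -/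
theorem fnA_eq_sum {v : ℝ} (hv : 0 < v) :
    fnA v = ∑ n ∈ Finset.range ⌊1 / v⌋₊, (1 + (Real.log (((n + 1 : ℕ) : ℝ) * v) : ℂ)) := by
  have hreal : (⌊1 / v⌋₊ * Real.log v + Real.log ((⌊1 / v⌋₊.factorial : ℕ) : ℝ) + ⌊1 / v⌋₊ : ℝ) =
      ∑ n ∈ Finset.range ⌊1 / v⌋₊, (1 + Real.log (((n + 1 : ℕ) : ℝ) * v)) := by
    rw [log_factorial_eq_sum]
    have : ∀ n ∈ Finset.range ⌊1 / v⌋₊, 1 + Real.log (((n + 1 : ℕ) : ℝ) * v) =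
        1 + Real.log ((n + 1 : ℕ) : ℝ) + Real.log v := by
      intro n _
      rw [Real.log_mul (by positivity) hv.ne']
      ring
    rw [Finset.sum_congr rfl this, Finset.sum_add_distrib, Finset.sum_add_distrib,
      Finset.sum_const, Finset.sum_const, Finset.card_range]
    simp only [nsmul_eq_mul]
    ring
  rw [fnA, hreal]
  push_cast
  rfl

/-- Padded form of `fnA_eq_sum` at `v = u/t`: for `0 < u`, `0 < t ≤ 1` and `M ≥ 1/u`,
`A(u/t) = Σ_{n<M} 𝟙[(n+1)u ≤ t]·(1 + log((n+1)u) − log t)`.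
[cite: Burnol2001, §2 (before Thm 2.4)] -/
theorem fnA_div_eq_sum_indicator {u t : ℝ} (hu : 0 < u) (ht : 0 < t) (ht1 : t ≤ 1) {M : ℕ}
    (hM : 1 / u ≤ M) :
    fnA (u / t) = ∑ n ∈ Finset.range M,
      (Ici (((n + 1 : ℕ) : ℝ) * u)).indicator
        (fun t : ℝ ↦ (1 + (Real.log (((n + 1 : ℕ) : ℝ) * u) : ℂ) - Real.log t)) t := by
  have hv : 0 < u / t := div_pos hu ht
  rw [fnA_eq_sum hv]
  have hfl : ⌊1 / (u / t)⌋₊ ≤ M := by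
    have h1 : 1 / (u / t) ≤ (M : ℝ) := by
      rw [one_div_div]
      exact le_trans (div_le_div_of_nonneg_right ht1 hu.le) (by simpa using hM)
    exact Nat.floor_le_of_le (by exact_mod_cast h1)
  have hmem : ∀ n : ℕ, (t ∈ Ici (((n + 1 : ℕ) : ℝ) * u) ↔ n < ⌊1 / (u / t)⌋₊) := by
    intro n
    rw [mem_Ici, one_div_div, ← Nat.add_one_le_iff, Nat.le_floor_iff (div_pos ht hu).le,
      le_div_iff₀ hu]
  rw [← Finset.sum_filter_add_sum_filter_not (Finset.range M) (fun n ↦ n < ⌊1 / (u / t)⌋₊)]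
  have hflt : (Finset.range M).filter (fun n ↦ n < ⌊1 / (u / t)⌋₊) = Finset.range ⌊1 / (u / t)⌋₊ := by
    ext n
    simp only [Finset.mem_filter, Finset.mem_range]
    omega
  rw [hflt]
  have hzero : ∑ n ∈ (Finset.range M).filter (fun n ↦ ¬ n < ⌊1 / (u / t)⌋₊),
      (Ici (((n + 1 : ℕ) : ℝ) * u)).indicator
        (fun t : ℝ ↦ (1 + (Real.log (((n + 1 : ℕ) : ℝ) * u) : ℂ) - Real.log t)) t = 0 := by
    refine Finset.sum_eq_zero fun n hn ↦ ?_
    rw [Finset.mem_filter] at hn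
    exact indicator_of_notMem (fun h ↦ hn.2 ((hmem n).1 h)) _
  rw [hzero, add_zero]
  refine Finset.sum_congr rfl fun n hn ↦ ?_
  rw [indicator_of_mem ((hmem n).2 (Finset.mem_range.1 hn))]
  have e : Real.log (((n + 1 : ℕ) : ℝ) * (u / t)) =
      Real.log (((n + 1 : ℕ) : ℝ) * u) - Real.log t := by
    rw [← mul_div_assoc, Real.log_div (by positivity) ht.ne']
  rw [e]
  push_cast
  ring

/-! ## `A ∈ L²(0,1)` (Stage 2 input: `|A(u)| ≤ 2 − log u` on `(0,1]`) -/

/-- Pointwise bound: `‖A(u)‖ ≤ 2 − log u` for `0 < u ≤ 1`, from `A = −{1/u} + ∫_u^∞ {1/v} dv/v`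
(`fnA_eq`): `{1/v}/v ≤ 1/v` on `(u,1]` and `= 1/v²` on `(1,∞)`.
[cite: Burnol2001, §2 (before Thm 2.4), TeX l.420–437] -/
theorem norm_fnA_le {u : ℝ} (hu : 0 < u) (hu1 : u ≤ 1) : ‖fnA u‖ ≤ 2 - Real.log u := by
  rw [fnA_eq hu]
  have hfr : ∀ v : ℝ, ‖(((Int.fract (1 / v) : ℝ)) : ℂ)‖ ≤ 1 := by
    intro v
    rw [Complex.norm_real, Real.norm_eq_abs, abs_of_nonneg (Int.fract_nonneg _)]
    exact (Int.fract_lt_one _).le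
  -- the integral: split at 1
  have hI1 : IntegrableOn (fun v : ℝ ↦ (((Int.fract (1 / v) : ℝ)) : ℂ) / v) (Ioc u 1) := by
    refine Measure.integrableOn_of_bounded (M := u⁻¹) measure_Ioc_lt_top.ne
      ((measurable_fract_one_div.div continuous_ofReal.measurable).aestronglyMeasurable) ?_
    filter_upwards [ae_restrict_mem measurableSet_Ioc] with v hv
    simp only [norm_div, Complex.norm_real, Real.norm_eq_abs]
    rw [abs_of_pos (hu.trans hv.1), abs_of_nonneg (Int.fract_nonneg _)]
    calc Int.fract (1 / v) / v ≤ 1 / v :=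
          div_le_div_of_nonneg_right (Int.fract_lt_one _).le (hu.trans hv.1).le
      _ ≤ u⁻¹ := by rw [one_div]; exact inv_anti₀ hu hv.1.le
  have hpt2 : ∀ v ∈ Ioi (1 : ℝ), (((Int.fract (1 / v) : ℝ)) : ℂ) / v = ((v ^ (-2 : ℝ) : ℝ) : ℂ) := by
    intro v hv
    have hv0 : (0 : ℝ) < v := zero_lt_one.trans hv
    have hfr1 : Int.fract (1 / v) = 1 / v := by
      rw [Int.fract_eq_self]
      exact ⟨by positivity, (div_lt_one hv0).2 hv⟩
    rw [hfr1, Real.rpow_neg hv0.le, show (2 : ℝ) = (2 : ℕ) by norm_num, Real.rpow_natCast]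
    have hv' : (v : ℂ) ≠ 0 := by exact_mod_cast hv0.ne'
    push_cast
    field_simp
  have hI2' : IntegrableOn (fun v : ℝ ↦ ((v ^ (-2 : ℝ) : ℝ) : ℂ)) (Ioi 1) :=
    (integrableOn_Ioi_rpow_of_lt (by norm_num : (-2 : ℝ) < -1) zero_lt_one).ofReal
  have hI2 : IntegrableOn (fun v : ℝ ↦ (((Int.fract (1 / v) : ℝ)) : ℂ) / v) (Ioi 1) :=
    hI2'.congr_fun (fun v hv ↦ (hpt2 v hv).symm) measurableSet_Ioi
  have hsplit : ∫ v in Ioi u, (((Int.fract (1 / v) : ℝ)) : ℂ) / v =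
      (∫ v in Ioc u 1, (((Int.fract (1 / v) : ℝ)) : ℂ) / v) +
        ∫ v in Ioi 1, (((Int.fract (1 / v) : ℝ)) : ℂ) / v := by
    rw [← Ioc_union_Ioi_eq_Ioi hu1, setIntegral_union (Ioc_disjoint_Ioi_same) measurableSet_Ioi hI1 hI2]
  have hb1 : ‖∫ v in Ioc u 1, (((Int.fract (1 / v) : ℝ)) : ℂ) / v‖ ≤ -Real.log u := by
    calc ‖∫ v in Ioc u 1, (((Int.fract (1 / v) : ℝ)) : ℂ) / v‖
        ≤ ∫ v in Ioc u 1, ‖(((Int.fract (1 / v) : ℝ)) : ℂ) / v‖ := norm_integral_le_integral_norm _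
      _ ≤ ∫ v in Ioc u 1, v⁻¹ := by
          refine setIntegral_mono_on hI1.norm ?_ measurableSet_Ioc fun v hv ↦ ?_
          · have hc : ContinuousOn (fun v : ℝ ↦ v⁻¹) (Icc u 1) :=
              continuousOn_inv₀.mono fun v hv ↦ (hu.trans_le hv.1).ne'
            exact hc.integrableOn_Icc.mono_set Ioc_subset_Icc_self
          · simp only [norm_div, Complex.norm_real, Real.norm_eq_abs]
            rw [abs_of_pos (hu.trans hv.1), abs_of_nonneg (Int.fract_nonneg _), ← one_div]
            exact div_le_div_of_nonneg_right (Int.fract_lt_one _).le (hu.trans hv.1).le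
      _ = -Real.log u := by
          rw [← intervalIntegral.integral_of_le hu1, integral_inv_of_pos hu zero_lt_one, div_eq_mul_inv,
            Real.log_mul one_ne_zero (inv_ne_zero hu.ne'), Real.log_one, Real.log_inv, zero_add]
  have hb2 : ‖∫ v in Ioi 1, (((Int.fract (1 / v) : ℝ)) : ℂ) / v‖ ≤ 1 := by
    rw [setIntegral_congr_fun measurableSet_Ioi hpt2, integral_complex_ofReal,
      integral_Ioi_rpow_of_lt (by norm_num) zero_lt_one, Complex.norm_real]
    norm_num
  calc ‖-(((Int.fract (1 / u) : ℝ)) : ℂ) + ∫ v in Ioi u, (((Int.fract (1 / v) : ℝ)) : ℂ) / v‖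
      ≤ ‖-(((Int.fract (1 / u) : ℝ)) : ℂ)‖ + ‖∫ v in Ioi u, (((Int.fract (1 / v) : ℝ)) : ℂ) / v‖ :=
        norm_add_le _ _
    _ ≤ 1 + (-Real.log u + 1) := by
        rw [norm_neg, hsplit]
        exact add_le_add (hfr u) ((norm_add_le _ _).trans (add_le_add hb1 hb2))
    _ = 2 - Real.log u := by ring

/-- **`A ∈ L²(0,1)`** (`‖A(u)‖ ≤ 2 − log u ≤ 6u^{−1/4}` on `(0,1]`).
[cite: Burnol2001, §2 (before Thm 2.4), TeX l.420–437] -/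
theorem memLp_fnA : MemLp fnA 2 (volume.restrict (Ioo (0 : ℝ) 1)) := by
  have hg_meas : AEStronglyMeasurable (fun u : ℝ ↦ (6 : ℝ) * u ^ (-(1 / 4 : ℝ)))
      (volume.restrict (Ioo (0 : ℝ) 1)) :=
    (continuous_const.measurable.mul (measurable_id.pow_const _)).aestronglyMeasurable
  have hg : MemLp (fun u : ℝ ↦ (6 : ℝ) * u ^ (-(1 / 4 : ℝ))) 2 (volume.restrict (Ioo (0 : ℝ) 1)) := by
    rw [memLp_two_iff_integrable_sq hg_meas]
    have h1 : IntegrableOn (fun u : ℝ ↦ (36 : ℝ) * u ^ (-(1 / 2 : ℝ))) (Ioo (0 : ℝ) 1) := by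
      have := (intervalIntegral.intervalIntegrable_rpow' (a := 0) (b := 1)
        (by norm_num : (-1 : ℝ) < -(1 / 2))).const_mul (36 : ℝ)
      rw [intervalIntegrable_iff_integrableOn_Ioc_of_le zero_le_one] at this
      exact this.mono_set Ioo_subset_Ioc_self
    refine h1.congr_fun (fun u hu ↦ ?_) measurableSet_Ioo
    have hu0 : 0 ≤ u := hu.1.le
    show (36 : ℝ) * u ^ (-(1 / 2 : ℝ)) = ((6 : ℝ) * u ^ (-(1 / 4 : ℝ))) ^ 2
    rw [mul_pow, ← Real.rpow_natCast (u ^ (-(1 / 4 : ℝ))) 2, ← Real.rpow_mul hu0]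
    norm_num
  refine hg.of_le measurable_fnA.aestronglyMeasurable ?_
  filter_upwards [ae_restrict_mem measurableSet_Ioo] with u hu
  have hu0 : 0 < u := hu.1
  have hq : 1 ≤ u ^ (-(1 / 4 : ℝ)) :=
    Real.one_le_rpow_of_pos_of_le_one_of_nonpos hu0 hu.2.le (by norm_num)
  have hlog : -Real.log u ≤ 4 * u ^ (-(1 / 4 : ℝ)) := by
    have h := Real.log_le_rpow_div (inv_nonneg.2 hu0.le) (by norm_num : (0 : ℝ) < 1 / 4)
    rw [Real.log_inv, Real.inv_rpow hu0.le, ← Real.rpow_neg hu0.le] at h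
    linarith
  have hgpos : 0 ≤ (6 : ℝ) * u ^ (-(1 / 4 : ℝ)) := by positivity
  rw [Real.norm_of_nonneg hgpos]
  linarith [norm_fnA_le hu0 hu.2.le]

namespace IsTest0

variable {ψ : ℝ → ℂ}

/-- `ψ(1) = 0` for `ψ ∈ 𝒮⁰_{≤1}` (continuity; `ψ = 0` on `(1,∞)`). [cite: Burnol2001, §2 (before Thm 2.6)] -/
theorem map_one (hψ : IsTest0 ψ) : ψ 1 = 0 := by
  have h1 : Tendsto ψ (𝓝[>] (1 : ℝ)) (𝓝 (ψ 1)) :=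
    hψ.continuous.continuousAt.tendsto.mono_left nhdsWithin_le_nhds
  have h2 : Tendsto ψ (𝓝[>] (1 : ℝ)) (𝓝 0) := by
    refine tendsto_const_nhds.congr' ?_
    filter_upwards [self_mem_nhdsWithin] with x (hx : 1 < x) using (hψ.eq_zero_of_one_lt hx).symm
  exact tendsto_nhds_unique h1 h2

/-- `φ̃(1) = 0`. [cite: Burnol2001, §2 (before Thm 2.7)] -/
theorem tilde_one (hψ : IsTest0 ψ) :
    ψ 1 + ψ (-1) - ∫ σ in (0 : ℝ)..1, (ψ (1 * σ) + ψ (-(1 * σ))) = 0 := by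
  rw [hψ.tilde_apply_of_pos one_pos, hψ.map_one, hψ.average_eq_zero_of_one_le le_rfl, sub_zero]

/-- `φ̃` is differentiable with continuous derivative. [cite: Burnol2001, §2 (before Thm 2.7)] -/
theorem hasDerivAt_tilde (hψ : IsTest0 ψ) (t : ℝ) :
    HasDerivAt (fun x : ℝ ↦ ψ x + ψ (-x) - ∫ σ in (0 : ℝ)..1, (ψ (x * σ) + ψ (-(x * σ))))
      (deriv (fun x : ℝ ↦ ψ x + ψ (-x) - ∫ σ in (0 : ℝ)..1, (ψ (x * σ) + ψ (-(x * σ)))) t) t :=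
  ((hψ.isTest_tilde.1.differentiable (by simp)).differentiableAt).hasDerivAt

/-- Continuity of `φ̃′`. [cite: Burnol2001, §2 (before Thm 2.7)] -/
theorem continuous_deriv_tilde (hψ : IsTest0 ψ) :
    Continuous (deriv (fun x : ℝ ↦ ψ x + ψ (-x) - ∫ σ in (0 : ℝ)..1, (ψ (x * σ) + ψ (-(x * σ))))) :=
  hψ.isTest_tilde.1.continuous_deriv (by simp)

/-- **The one-variable identity** (`0 < x ≤ 1`):
`ψ(x) = −∫_x^1 φ̃′(t)·(1 + log x − log t) dt` — integration by parts
(`φ̃(1) = 0`, `d/dt(1 + log x − log t) = −1/t`) and `∫_x^1 φ̃(t) dt/t = −H(ψ)(x)`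
(`integral_sub_average_div_eq`), with `φ̃ = ψ − H(ψ)` on `(0,∞)`.
[cite: Burnol2001, §2 (Thm 2.4 via Thm 2.6/2.7)] -/
theorem eq_neg_integral_deriv_tilde_mul (hψ : IsTest0 ψ) {x : ℝ} (hx : 0 < x) (hx1 : x ≤ 1) :
    ψ x = -∫ t in x..1,
      deriv (fun y : ℝ ↦ ψ y + ψ (-y) - ∫ σ in (0 : ℝ)..1, (ψ (y * σ) + ψ (-(y * σ)))) t *
        (1 + (Real.log x : ℂ) - Real.log t) := by
  -- integration by parts
  have hV : ∀ t ∈ uIcc x 1, HasDerivAt (fun t : ℝ ↦ (1 + (Real.log x : ℂ) - Real.log t))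
      (-(1 / (t : ℂ))) t := by
    intro t ht
    rw [uIcc_of_le hx1] at ht
    have ht0 : 0 < t := hx.trans_le ht.1
    have h1 : HasDerivAt (fun t : ℝ ↦ (Real.log t : ℂ)) ((t⁻¹ : ℝ) : ℂ) t :=
      (Real.hasDerivAt_log ht0.ne').ofReal_comp
    have h2 := (hasDerivAt_const t (1 + (Real.log x : ℂ))).sub h1
    refine h2.congr_deriv ?_
    rw [zero_sub, one_div, ofReal_inv]
  have hparts := intervalIntegral.integral_mul_deriv_eq_deriv_mul hV
    (fun t _ ↦ hψ.hasDerivAt_tilde t)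
    (by
      apply ContinuousOn.intervalIntegrable
      rw [uIcc_of_le hx1]
      refine ContinuousOn.neg (ContinuousOn.div continuousOn_const continuous_ofReal.continuousOn ?_)
      intro t ht; exact_mod_cast (hx.trans_le ht.1).ne')
    (hψ.continuous_deriv_tilde.intervalIntegrable _ _)
  -- `∫_x^1 φ̃(t) dt/t = -H(ψ)(x)`
  have hdiv : ∫ t in x..1, (ψ t + ψ (-t) - ∫ σ in (0 : ℝ)..1, (ψ (t * σ) + ψ (-(t * σ)))) / (t : ℂ) =
      -∫ σ in (0 : ℝ)..1, ψ (x * σ) := by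
    have hcongr : ∀ t ∈ uIcc x 1,
        (ψ t + ψ (-t) - ∫ σ in (0 : ℝ)..1, (ψ (t * σ) + ψ (-(t * σ)))) / (t : ℂ) =
          (ψ t - ∫ σ in (0 : ℝ)..1, ψ (t * σ)) / (t : ℂ) := by
      intro t ht
      rw [uIcc_of_le hx1] at ht
      rw [hψ.tilde_apply_of_pos (hx.trans_le ht.1)]
    rw [intervalIntegral.integral_congr hcongr, hψ.integral_sub_average_div_eq hx hx1,
      hψ.average_eq_zero_of_one_le le_rfl, zero_sub]
  have e1 : ∫ t in x..1,
      deriv (fun y : ℝ ↦ ψ y + ψ (-y) - ∫ σ in (0 : ℝ)..1, (ψ (y * σ) + ψ (-(y * σ)))) t *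
        (1 + (Real.log x : ℂ) - Real.log t) =
      ∫ t in x..1, (1 + (Real.log x : ℂ) - Real.log t) *
        deriv (fun y : ℝ ↦ ψ y + ψ (-y) - ∫ σ in (0 : ℝ)..1, (ψ (y * σ) + ψ (-(y * σ)))) t :=
    intervalIntegral.integral_congr fun t _ ↦ mul_comm _ _
  have e2 : ∫ t in x..1, -(1 / (t : ℂ)) *
      (ψ t + ψ (-t) - ∫ σ in (0 : ℝ)..1, (ψ (t * σ) + ψ (-(t * σ)))) =
      -∫ t in x..1, (ψ t + ψ (-t) - ∫ σ in (0 : ℝ)..1, (ψ (t * σ) + ψ (-(t * σ)))) / (t : ℂ) := by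
    rw [← intervalIntegral.integral_neg]
    exact intervalIntegral.integral_congr fun t _ ↦ by ring
  rw [e1, hparts, hψ.tilde_one, mul_zero, zero_sub, hψ.tilde_apply_of_pos hx, e2, hdiv]
  ring

/-- Interval-integrability on `[0,1]` of the lattice terms `𝟙[c ≤ t] φ̃′(t)(1 + log c − log t)`,
`c > 0`. [cite: Burnol2001, §2 (Thm 2.4 via Thm 2.6/2.7)] -/
theorem intervalIntegrable_indicator_term (hψ : IsTest0 ψ) {c : ℝ} (hc : 0 < c) :
    IntervalIntegrable (fun t : ℝ ↦
      deriv (fun y : ℝ ↦ ψ y + ψ (-y) - ∫ σ in (0 : ℝ)..1, (ψ (y * σ) + ψ (-(y * σ)))) t *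
        (Ici c).indicator (fun t : ℝ ↦ (1 + (Real.log c : ℂ) - Real.log t)) t) volume 0 1 := by
  rw [intervalIntegrable_iff_integrableOn_Ioc_of_le zero_le_one]
  have hcont : ContinuousOn (fun t : ℝ ↦
      deriv (fun y : ℝ ↦ ψ y + ψ (-y) - ∫ σ in (0 : ℝ)..1, (ψ (y * σ) + ψ (-(y * σ)))) t *
        (1 + (Real.log c : ℂ) - Real.log t)) (Icc c 1) := by
    refine hψ.continuous_deriv_tilde.continuousOn.mul (continuousOn_const.sub ?_)
    exact (continuous_ofReal.comp_continuousOn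
      (Real.continuousOn_log.mono fun t ht ↦ (hc.trans_le ht.1).ne'))
  have hF : (fun t : ℝ ↦
      deriv (fun y : ℝ ↦ ψ y + ψ (-y) - ∫ σ in (0 : ℝ)..1, (ψ (y * σ) + ψ (-(y * σ)))) t *
        (Ici c).indicator (fun t : ℝ ↦ (1 + (Real.log c : ℂ) - Real.log t)) t) =
      (Ici c).indicator (fun t : ℝ ↦
        deriv (fun y : ℝ ↦ ψ y + ψ (-y) - ∫ σ in (0 : ℝ)..1, (ψ (y * σ) + ψ (-(y * σ)))) t *
          (1 + (Real.log c : ℂ) - Real.log t)) := by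
    funext t
    rw [Set.indicator_mul_right]
  rw [hF, IntegrableOn, integrable_indicator_iff measurableSet_Ici, IntegrableOn,
    Measure.restrict_restrict measurableSet_Ici]
  exact hcont.integrableOn_Icc.mono_set fun t ht ↦ ⟨ht.1, ht.2.2⟩

/-- `∫_0^1 𝟙[c ≤ t] F(t) dt = ∫_c^1 F` for `0 < c ≤ 1`. [folklore] -/
private theorem integral_indicator_Ici_eq (F : ℝ → ℂ) {c : ℝ} (hc : 0 < c) (hc1 : c ≤ 1) :
    ∫ t in (0 : ℝ)..1, (Ici c).indicator F t = ∫ t in c..1, F t := by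
  rw [intervalIntegral.integral_of_le zero_le_one, setIntegral_indicator measurableSet_Ici,
    intervalIntegral.integral_of_le hc1]
  have hset : Ioc (0 : ℝ) 1 ∩ Ici c = Icc c 1 := by
    ext t
    simp only [mem_inter_iff, mem_Ioc, mem_Ici, mem_Icc]
    constructor
    · rintro ⟨⟨_, h1⟩, h2⟩; exact ⟨h2, h1⟩
    · rintro ⟨h1, h2⟩; exact ⟨⟨hc.trans_le h1, h2⟩, h1⟩
  rw [hset, setIntegral_congr_set Ioc_ae_eq_Icc]

/-- `∫_0^1 𝟙[c ≤ t] F(t) dt = 0` for `c > 1`. [folklore] -/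
private theorem integral_indicator_Ici_eq_zero (F : ℝ → ℂ) {c : ℝ} (hc1 : 1 < c) :
    ∫ t in (0 : ℝ)..1, (Ici c).indicator F t = 0 := by
  have : ∀ t ∈ uIcc (0 : ℝ) 1, (Ici c).indicator F t = (fun _ ↦ (0 : ℂ)) t := by
    intro t ht
    rw [uIcc_of_le zero_le_one] at ht
    exact indicator_of_notMem (fun h : t ∈ Ici c ↦ by
      have := mem_Ici.1 h; linarith [ht.2]) _
  rw [intervalIntegral.integral_congr this, intervalIntegral.integral_zero]

/-- **`T(ψ)` is a continuous superposition of the dilates of `A`**: for `ψ ∈ 𝒮⁰_{≤1}` and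
`u > 0`, `T(ψ)(u) = −∫_0^1 φ̃′(t)·A(u/t) dt` (`A(u/t) = √t·(U(t)A)(u)`; both sides vanish for
`u > 1`): expand `A(u/t)` as
the lattice sum `fnA_div_eq_sum_indicator`, exchange the finite sum with the integral, and apply
the one-variable identity `eq_neg_integral_deriv_tilde_mul` at each point `(n+1)u ≤ 1`.
[cite: Burnol2001, §2 (Thm 2.4 via Thm 2.6/2.7)] -/
theorem mapT_eq_neg_integral_deriv_tilde_mul_fnA (hψ : IsTest0 ψ) {u : ℝ} (hu : 0 < u) :
    mapT ψ u = -∫ t in (0 : ℝ)..1,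
      deriv (fun y : ℝ ↦ ψ y + ψ (-y) - ∫ σ in (0 : ℝ)..1, (ψ (y * σ) + ψ (-(y * σ)))) t *
        fnA (u / t) := by
  have hM : 1 / u ≤ (⌈1 / u⌉₊ : ℕ) := Nat.le_ceil _
  -- expand `A(u/t)` on `[0,1]`
  have hA : ∀ t ∈ uIcc (0 : ℝ) 1,
      deriv (fun y : ℝ ↦ ψ y + ψ (-y) - ∫ σ in (0 : ℝ)..1, (ψ (y * σ) + ψ (-(y * σ)))) t *
        fnA (u / t) =
      ∑ n ∈ Finset.range ⌈1 / u⌉₊,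
        deriv (fun y : ℝ ↦ ψ y + ψ (-y) - ∫ σ in (0 : ℝ)..1, (ψ (y * σ) + ψ (-(y * σ)))) t *
          (Ici (((n + 1 : ℕ) : ℝ) * u)).indicator
            (fun t : ℝ ↦ (1 + (Real.log (((n + 1 : ℕ) : ℝ) * u) : ℂ) - Real.log t)) t := by
    intro t ht
    rw [uIcc_of_le zero_le_one] at ht
    rcases eq_or_lt_of_le ht.1 with h0 | ht0
    · -- `t = 0`: both sides vanish
      rw [← h0]
      have hz : fnA (u / 0) = 0 := by simp [fnA]
      rw [hz, mul_zero]
      refine (Finset.sum_eq_zero fun n _ ↦ ?_).symm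
      rw [indicator_of_notMem (fun h : (0 : ℝ) ∈ Ici (((n + 1 : ℕ) : ℝ) * u) ↦
        absurd (mem_Ici.1 h) (not_le.2 (by positivity))), mul_zero]
    · rw [fnA_div_eq_sum_indicator hu ht0 ht.2 hM, Finset.mul_sum]
  rw [intervalIntegral.integral_congr hA,
    intervalIntegral.integral_finsetSum fun n _ ↦ hψ.intervalIntegrable_indicator_term (by positivity),
    hψ.mapT_eq_sum_range hu hM, ← Finset.sum_neg_distrib]
  refine Finset.sum_congr rfl fun n _ ↦ ?_
  have hc : 0 < ((n + 1 : ℕ) : ℝ) * u := by positivity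
  -- move the indicator outside the product
  have hind : (fun t : ℝ ↦
      deriv (fun y : ℝ ↦ ψ y + ψ (-y) - ∫ σ in (0 : ℝ)..1, (ψ (y * σ) + ψ (-(y * σ)))) t *
        (Ici (((n + 1 : ℕ) : ℝ) * u)).indicator
          (fun t : ℝ ↦ (1 + (Real.log (((n + 1 : ℕ) : ℝ) * u) : ℂ) - Real.log t)) t) =
      (Ici (((n + 1 : ℕ) : ℝ) * u)).indicator (fun t : ℝ ↦
        deriv (fun y : ℝ ↦ ψ y + ψ (-y) - ∫ σ in (0 : ℝ)..1, (ψ (y * σ) + ψ (-(y * σ)))) t *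
          (1 + (Real.log (((n + 1 : ℕ) : ℝ) * u) : ℂ) - Real.log t)) := by
    funext t
    rw [Set.indicator_mul_right]
  rw [hind]
  by_cases hc1 : ((n + 1 : ℕ) : ℝ) * u ≤ 1
  · rw [integral_indicator_Ici_eq _ hc hc1, hψ.eq_neg_integral_deriv_tilde_mul hc hc1]
  · rw [integral_indicator_Ici_eq_zero _ (not_le.1 hc1), hψ.eq_zero_of_one_lt (not_le.1 hc1),
      neg_zero]

/-- Interval-integrability of `t ↦ φ̃′(t)A(u/t)` on `[0,1]` (a finite sum of the lattice terms).
[cite: Burnol2001, §2 (Thm 2.4 via Thm 2.6/2.7)] -/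
theorem intervalIntegrable_deriv_tilde_mul_fnA (hψ : IsTest0 ψ) {u : ℝ} (hu : 0 < u) :
    IntervalIntegrable (fun t : ℝ ↦
      deriv (fun y : ℝ ↦ ψ y + ψ (-y) - ∫ σ in (0 : ℝ)..1, (ψ (y * σ) + ψ (-(y * σ)))) t *
        fnA (u / t)) volume 0 1 := by
  have hM : 1 / u ≤ (⌈1 / u⌉₊ : ℕ) := Nat.le_ceil _
  have hsum : IntervalIntegrable (fun t : ℝ ↦ ∑ n ∈ Finset.range ⌈1 / u⌉₊,
      deriv (fun y : ℝ ↦ ψ y + ψ (-y) - ∫ σ in (0 : ℝ)..1, (ψ (y * σ) + ψ (-(y * σ)))) t *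
        (Ici (((n + 1 : ℕ) : ℝ) * u)).indicator
          (fun t : ℝ ↦ (1 + (Real.log (((n + 1 : ℕ) : ℝ) * u) : ℂ) - Real.log t)) t) volume 0 1 := by
    have := IntervalIntegrable.sum (μ := volume) (a := (0 : ℝ)) (b := 1) (Finset.range ⌈1 / u⌉₊)
      (fun n _ ↦ hψ.intervalIntegrable_indicator_term (c := ((n + 1 : ℕ) : ℝ) * u) (by positivity))
    have hfun : (fun t : ℝ ↦ ∑ n ∈ Finset.range ⌈1 / u⌉₊,
        deriv (fun y : ℝ ↦ ψ y + ψ (-y) - ∫ σ in (0 : ℝ)..1, (ψ (y * σ) + ψ (-(y * σ)))) t *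
          (Ici (((n + 1 : ℕ) : ℝ) * u)).indicator
            (fun t : ℝ ↦ (1 + (Real.log (((n + 1 : ℕ) : ℝ) * u) : ℂ) - Real.log t)) t) =
        ∑ n ∈ Finset.range ⌈1 / u⌉₊, fun t : ℝ ↦
          deriv (fun y : ℝ ↦ ψ y + ψ (-y) - ∫ σ in (0 : ℝ)..1, (ψ (y * σ) + ψ (-(y * σ)))) t *
            (Ici (((n + 1 : ℕ) : ℝ) * u)).indicator
              (fun t : ℝ ↦ (1 + (Real.log (((n + 1 : ℕ) : ℝ) * u) : ℂ) - Real.log t)) t := by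
      funext t
      simp only [Finset.sum_apply]
    rw [hfun]
    exact this
  refine hsum.congr ?_
  rw [uIoc_of_le zero_le_one]
  intro t ht
  simp only
  rw [fnA_div_eq_sum_indicator hu ht.1 ht.2 hM, Finset.mul_sum]

end IsTest0

/-! ## Stage 2, first step: the uniform-grid Riemann sum as an integral -/

/-- A uniform-grid step function integrates to its Riemann sum:
`∫_0^1 F(⌈Kt⌉/K) dt = K^{-1} Σ_{j<K} F((j+1)/K)`. [folklore] -/
private theorem integral_comp_gridCeil_eq_sum (F : ℝ → ℂ) {K : ℕ} (hK : 0 < K) :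
    ∫ t in (0 : ℝ)..1, F ((⌈(K : ℝ) * t⌉₊ : ℝ) / K) =
      (K : ℂ)⁻¹ * ∑ j ∈ Finset.range K, F (((j + 1 : ℕ) : ℝ) / K) := by
  have hK0 : (0 : ℝ) < K := Nat.cast_pos.2 hK
  -- value on each cell
  have hcell : ∀ j : ℕ, ∀ t ∈ Ioc ((j : ℝ) / K) (((j + 1 : ℕ) : ℝ) / K),
      F ((⌈(K : ℝ) * t⌉₊ : ℝ) / K) = F (((j + 1 : ℕ) : ℝ) / K) := by
    intro j t ht
    have h1 : (j : ℝ) < K * t := by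
      have := ht.1; rw [div_lt_iff₀ hK0] at this; linarith
    have h2 : (K : ℝ) * t ≤ ((j + 1 : ℕ) : ℝ) := by
      have := ht.2; rw [le_div_iff₀ hK0] at this; linarith
    have hceil : ⌈(K : ℝ) * t⌉₊ = j + 1 := by
      rw [Nat.ceil_eq_iff (Nat.succ_ne_zero j)]
      exact ⟨by simpa using h1, h2⟩
    rw [hceil]
  have hint : ∀ j < K, IntervalIntegrable (fun t : ℝ ↦ F ((⌈(K : ℝ) * t⌉₊ : ℝ) / K)) volume
      ((j : ℝ) / K) (((j + 1 : ℕ) : ℝ) / K) := by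
    intro j _
    have hle : (j : ℝ) / K ≤ ((j + 1 : ℕ) : ℝ) / K :=
      div_le_div_of_nonneg_right (by push_cast; linarith) hK0.le
    rw [intervalIntegrable_iff_integrableOn_Ioc_of_le hle]
    have hc : IntegrableOn (fun _ : ℝ ↦ F (((j + 1 : ℕ) : ℝ) / K))
        (Ioc ((j : ℝ) / K) (((j + 1 : ℕ) : ℝ) / K)) :=
      (continuousOn_const.integrableOn_Icc (b := ((j + 1 : ℕ) : ℝ) / K)).mono_set
        Ioc_subset_Icc_self
    exact hc.congr_fun (fun t ht ↦ (hcell j t ht).symm) measurableSet_Ioc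
  have hadj := intervalIntegral.sum_integral_adjacent_intervals
    (a := fun j : ℕ ↦ (j : ℝ) / K) (μ := volume) (f := fun t : ℝ ↦ F ((⌈(K : ℝ) * t⌉₊ : ℝ) / K))
    (n := K) (fun j hj ↦ by simpa using hint j hj)
  simp only [Nat.cast_zero, zero_div, div_self hK0.ne'] at hadj
  rw [← hadj, Finset.mul_sum]
  refine Finset.sum_congr rfl fun j hj ↦ ?_
  have hle : (j : ℝ) / K ≤ ((j + 1 : ℕ) : ℝ) / K :=
    div_le_div_of_nonneg_right (by push_cast; linarith) hK0.le
  rw [intervalIntegral.integral_of_le hle, setIntegral_congr_fun measurableSet_Ioc (hcell j),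
    setIntegral_const, Real.volume_real_Ioc_of_le hle, Complex.real_smul]
  congr 1
  push_cast
  field_simp
  ring

namespace IsTest0

variable {ψ : ℝ → ℂ}

/-- **Error representation for the Riemann sums** (Stage 2, first step): with the grid points
`t_j = (j+1)/K`,
`T(ψ)(u) − K^{-1}Σ_{j<K} (−φ̃′(t_j) A(u/t_j)) = −∫_0^1 [φ̃′(t)A(u/t) − φ̃′(τ_K t)A(u/τ_K t)] dt`,
`τ_K(t) = ⌈Kt⌉/K`; the finite sum is a linear combination of the dilates `U(t_j)A`
(`A(u/t_j) = √t_j·(U(t_j)A)(u)`). What remains for `Burnol2001_thm_2_4_holds` is the smallness of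
the right-hand side in `L²(0,1)` as `K → ∞` (`|∫G|² ≤ ∫|G|²`, Tonelli, and the `L²`-continuity of
`t ↦ A(·/t)`, by density from `memLp_fnA`). [cite: Burnol2001, §2 (Thm 2.4 via Thm 2.6/2.7)] -/
theorem mapT_sub_gridSum_eq (hψ : IsTest0 ψ) {u : ℝ} (hu : 0 < u) {K : ℕ} (hK : 0 < K) :
    mapT ψ u - (K : ℂ)⁻¹ * ∑ j ∈ Finset.range K,
        -(deriv (fun y : ℝ ↦ ψ y + ψ (-y) - ∫ σ in (0 : ℝ)..1, (ψ (y * σ) + ψ (-(y * σ))))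
            (((j + 1 : ℕ) : ℝ) / K) * fnA (u / (((j + 1 : ℕ) : ℝ) / K))) =
      -∫ t in (0 : ℝ)..1,
        (deriv (fun y : ℝ ↦ ψ y + ψ (-y) - ∫ σ in (0 : ℝ)..1, (ψ (y * σ) + ψ (-(y * σ)))) t *
            fnA (u / t) -
          deriv (fun y : ℝ ↦ ψ y + ψ (-y) - ∫ σ in (0 : ℝ)..1, (ψ (y * σ) + ψ (-(y * σ))))
              ((⌈(K : ℝ) * t⌉₊ : ℝ) / K) * fnA (u / ((⌈(K : ℝ) * t⌉₊ : ℝ) / K))) := by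
  have hK0 : (0 : ℝ) < K := Nat.cast_pos.2 hK
  have hstep := integral_comp_gridCeil_eq_sum (fun s : ℝ ↦
    -(deriv (fun y : ℝ ↦ ψ y + ψ (-y) - ∫ σ in (0 : ℝ)..1, (ψ (y * σ) + ψ (-(y * σ)))) s *
      fnA (u / s))) hK
  -- integrability of the grid function: constant on each cell
  have hint2 : IntervalIntegrable (fun t : ℝ ↦
      deriv (fun y : ℝ ↦ ψ y + ψ (-y) - ∫ σ in (0 : ℝ)..1, (ψ (y * σ) + ψ (-(y * σ))))
        ((⌈(K : ℝ) * t⌉₊ : ℝ) / K) * fnA (u / ((⌈(K : ℝ) * t⌉₊ : ℝ) / K))) volume 0 1 := by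
    -- `IntervalIntegrable.trans_iterate` on the cells
    have hcellint : ∀ j < K, IntervalIntegrable (fun t : ℝ ↦
        deriv (fun y : ℝ ↦ ψ y + ψ (-y) - ∫ σ in (0 : ℝ)..1, (ψ (y * σ) + ψ (-(y * σ))))
          ((⌈(K : ℝ) * t⌉₊ : ℝ) / K) * fnA (u / ((⌈(K : ℝ) * t⌉₊ : ℝ) / K))) volume
        ((fun j : ℕ ↦ (j : ℝ) / K) j) ((fun j : ℕ ↦ (j : ℝ) / K) (j + 1)) := by
      intro j _
      have hle : (j : ℝ) / K ≤ ((j + 1 : ℕ) : ℝ) / K :=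
        div_le_div_of_nonneg_right (by push_cast; linarith) hK0.le
      simp only [Nat.cast_succ] at hle ⊢
      rw [intervalIntegrable_iff_integrableOn_Ioc_of_le hle]
      have hc : IntegrableOn (fun _ : ℝ ↦
          deriv (fun y : ℝ ↦ ψ y + ψ (-y) - ∫ σ in (0 : ℝ)..1, (ψ (y * σ) + ψ (-(y * σ))))
            (((j : ℝ) + 1) / K) * fnA (u / (((j : ℝ) + 1) / K)))
          (Ioc ((j : ℝ) / K) (((j : ℝ) + 1) / K)) :=
        (continuousOn_const.integrableOn_Icc (b := ((j : ℝ) + 1) / K)).mono_set Ioc_subset_Icc_self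
      refine hc.congr_fun (fun t ht ↦ ?_) measurableSet_Ioc
      have h1 : (j : ℝ) < K * t := by
        have := ht.1; rw [div_lt_iff₀ hK0] at this; linarith
      have h2 : (K : ℝ) * t ≤ ((j + 1 : ℕ) : ℝ) := by
        have := ht.2; rw [le_div_iff₀ hK0] at this; push_cast; linarith
      have hceil : ⌈(K : ℝ) * t⌉₊ = j + 1 := by
        rw [Nat.ceil_eq_iff (Nat.succ_ne_zero j)]
        exact ⟨by simpa using h1, h2⟩
      simp only [hceil, Nat.cast_succ]
    have := IntervalIntegrable.trans_iterate hcellint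
    simpa [div_self hK0.ne'] using this
  rw [hψ.mapT_eq_neg_integral_deriv_tilde_mul_fnA hu, ← hstep, intervalIntegral.integral_neg,
    sub_neg_eq_add, intervalIntegral.integral_sub (hψ.intervalIntegrable_deriv_tilde_mul_fnA hu) hint2]
  ring

end IsTest0


end Burnol2001

end Literature.NumberTheory.LFunctions


namespace Literature.NumberTheory.LFunctions

namespace Burnol2001

open scoped ENNReal

/-! ## Stage 2, second step: `L²(0,1)`-norm of a `t`-average (Cauchy–Schwarz in `t`, Tonelli) -/

/-- `∫⁻ ‖f‖ₑ² = ‖f‖₂²`. [folklore] -/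
private theorem lintegral_enorm_sq_eq (f : ℝ → ℂ) (μ : Measure ℝ) :
    ∫⁻ x, ‖f x‖ₑ ^ (2 : ℝ) ∂μ = eLpNorm f 2 μ ^ (2 : ℝ) := by
  rw [eLpNorm_eq_lintegral_rpow_enorm_toReal two_ne_zero ENNReal.ofNat_ne_top, ENNReal.toReal_ofNat,
    ← ENNReal.rpow_mul]
  norm_num

/-- **`L²` norm of a `t`-average.** If `G` is jointly measurable and `‖G(t,·)‖_{L²(0,1)} ≤ C` for
every `t ∈ (0,1]`, then `‖u ↦ ∫_0^1 G(t,u) dt‖_{L²(0,1)} ≤ C` (Cauchy–Schwarz in `t` on the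
probability space `(0,1]`, then Tonelli). [folklore] -/
private theorem eLpNorm_intervalIntegral_le {G : ℝ → ℝ → ℂ} (hG : Measurable (Function.uncurry G))
    {C : ℝ≥0∞} (hC : ∀ t ∈ Ioc (0 : ℝ) 1, eLpNorm (G t) 2 (volume.restrict (Ioo (0 : ℝ) 1)) ≤ C) :
    eLpNorm (fun u ↦ ∫ t in (0 : ℝ)..1, G t u) 2 (volume.restrict (Ioo (0 : ℝ) 1)) ≤ C := by
  have hν1 : (volume.restrict (Ioc (0 : ℝ) 1)) univ = 1 := by
    rw [Measure.restrict_apply_univ, Real.volume_Ioc]; simp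
  -- Step 1: pointwise Cauchy–Schwarz in `t`
  have h1 : ∀ u : ℝ, ‖∫ t in (0 : ℝ)..1, G t u‖ₑ ^ (2 : ℝ) ≤
      ∫⁻ t in Ioc (0 : ℝ) 1, ‖G t u‖ₑ ^ (2 : ℝ) := by
    intro u
    have hmeas : Measurable (fun t : ℝ ↦ G t u) :=
      hG.comp (measurable_id.prodMk measurable_const)
    rw [intervalIntegral.integral_of_le zero_le_one]
    have hCS := ENNReal.lintegral_mul_le_Lp_mul_Lq (volume.restrict (Ioc (0 : ℝ) 1))
      Real.HolderConjugate.two_two (f := fun t : ℝ ↦ ‖G t u‖ₑ) (g := fun _ : ℝ ↦ (1 : ℝ≥0∞))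
      hmeas.enorm.aemeasurable aemeasurable_const
    simp only [Pi.mul_apply, mul_one, ENNReal.one_rpow, lintegral_const, hν1, mul_one] at hCS
    calc ‖∫ t in Ioc (0 : ℝ) 1, G t u‖ₑ ^ (2 : ℝ)
        ≤ (∫⁻ t in Ioc (0 : ℝ) 1, ‖G t u‖ₑ) ^ (2 : ℝ) :=
          ENNReal.rpow_le_rpow (enorm_integral_le_lintegral_enorm _) (by norm_num)
      _ ≤ ((∫⁻ t in Ioc (0 : ℝ) 1, ‖G t u‖ₑ ^ (2 : ℝ)) ^ (1 / (2 : ℝ))) ^ (2 : ℝ) :=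
          ENNReal.rpow_le_rpow hCS (by norm_num)
      _ = ∫⁻ t in Ioc (0 : ℝ) 1, ‖G t u‖ₑ ^ (2 : ℝ) := by
          rw [← ENNReal.rpow_mul]; norm_num
  -- Step 2: integrate in `u` and swap
  have hswap : ∫⁻ u in Ioo (0 : ℝ) 1, ∫⁻ t in Ioc (0 : ℝ) 1, ‖G t u‖ₑ ^ (2 : ℝ) =
      ∫⁻ t in Ioc (0 : ℝ) 1, ∫⁻ u in Ioo (0 : ℝ) 1, ‖G t u‖ₑ ^ (2 : ℝ) := by
    refine lintegral_lintegral_swap ?_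
    have : Measurable (fun p : ℝ × ℝ ↦ ‖Function.uncurry G (p.2, p.1)‖ₑ ^ (2 : ℝ)) :=
      ((hG.comp measurable_swap).enorm.pow_const _)
    exact this.aemeasurable
  have h2 : ∫⁻ u in Ioo (0 : ℝ) 1, ‖∫ t in (0 : ℝ)..1, G t u‖ₑ ^ (2 : ℝ) ≤ C ^ (2 : ℝ) := by
    calc ∫⁻ u in Ioo (0 : ℝ) 1, ‖∫ t in (0 : ℝ)..1, G t u‖ₑ ^ (2 : ℝ)
        ≤ ∫⁻ u in Ioo (0 : ℝ) 1, ∫⁻ t in Ioc (0 : ℝ) 1, ‖G t u‖ₑ ^ (2 : ℝ) :=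
          lintegral_mono fun u ↦ h1 u
      _ = ∫⁻ t in Ioc (0 : ℝ) 1, ∫⁻ u in Ioo (0 : ℝ) 1, ‖G t u‖ₑ ^ (2 : ℝ) := hswap
      _ ≤ ∫⁻ _ in Ioc (0 : ℝ) 1, C ^ (2 : ℝ) := by
          refine lintegral_mono_ae ?_
          filter_upwards [ae_restrict_mem measurableSet_Ioc] with t ht
          rw [lintegral_enorm_sq_eq]
          exact ENNReal.rpow_le_rpow (hC t ht) (by norm_num)
      _ = C ^ (2 : ℝ) := by rw [lintegral_const, hν1, mul_one]
  -- Step 3: take square roots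
  calc eLpNorm (fun u ↦ ∫ t in (0 : ℝ)..1, G t u) 2 (volume.restrict (Ioo (0 : ℝ) 1))
      = (∫⁻ u in Ioo (0 : ℝ) 1, ‖∫ t in (0 : ℝ)..1, G t u‖ₑ ^ (2 : ℝ)) ^ (1 / (2 : ℝ)) := by
        rw [eLpNorm_eq_lintegral_rpow_enorm_toReal two_ne_zero ENNReal.ofNat_ne_top,
          ENNReal.toReal_ofNat]
    _ ≤ (C ^ (2 : ℝ)) ^ (1 / (2 : ℝ)) := ENNReal.rpow_le_rpow h2 (by norm_num)
    _ = C := by rw [← ENNReal.rpow_mul]; norm_num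

/-! ## Stage 2, third step: dilation in `L²` -/

/-- Change of variables: `‖F(·/t)‖_{L²(ℝ)} = t^{1/2}‖F‖_{L²(ℝ)}` (`t > 0`), hence
`‖F(·/t)‖_{L²(0,1)} ≤ t^{1/2}‖F‖_{L²(ℝ)}`. [folklore] -/
private theorem eLpNorm_comp_div_le {F : ℝ → ℂ} (hF : AEStronglyMeasurable F volume) {t : ℝ}
    (ht : 0 < t) :
    eLpNorm (fun u : ℝ ↦ F (u / t)) 2 (volume.restrict (Ioo (0 : ℝ) 1)) ≤
      ENNReal.ofReal t ^ (1 / (2 : ℝ)) * eLpNorm F 2 volume := by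
  have ht' : t⁻¹ ≠ 0 := inv_ne_zero ht.ne'
  have hfun : (fun u : ℝ ↦ F (u / t)) = F ∘ fun u : ℝ ↦ t⁻¹ * u := by
    funext u; simp [div_eq_inv_mul]
  calc eLpNorm (fun u : ℝ ↦ F (u / t)) 2 (volume.restrict (Ioo (0 : ℝ) 1))
      ≤ eLpNorm (fun u : ℝ ↦ F (u / t)) 2 volume := eLpNorm_mono_measure _ Measure.restrict_le_self
    _ = eLpNorm F 2 (Measure.map (fun u : ℝ ↦ t⁻¹ * u) volume) := by
        rw [hfun, ← eLpNorm_map_measure _ (measurable_const_mul _).aemeasurable]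
        rw [Real.map_volume_mul_left ht']
        exact hF.smul_measure _
    _ = ENNReal.ofReal t ^ (1 / (2 : ℝ)) * eLpNorm F 2 volume := by
        rw [Real.map_volume_mul_left ht', eLpNorm_smul_measure_of_ne_top ENNReal.ofNat_ne_top,
          smul_eq_mul, inv_inv, abs_of_pos ht]
        norm_num

/-- `A` vanishes off `(0,1]`. [folklore] -/
private theorem fnA_eq_indicator : fnA = (Ioc (0 : ℝ) 1).indicator fnA := by
  funext u
  by_cases hu : u ∈ Ioc (0 : ℝ) 1
  · rw [indicator_of_mem hu]
  · rw [indicator_of_notMem hu]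
    rw [mem_Ioc, not_and_or, not_lt, not_le] at hu
    rcases hu with h | h
    · have h0 : ⌊u⁻¹⌋₊ = 0 := Nat.floor_of_nonpos (inv_nonpos.2 h)
      simp [fnA, h0]
    · exact fnA_eq_zero_of_one_lt h

/-- `A ∈ L²(ℝ)`. [folklore] -/
private theorem memLp_fnA_volume : MemLp fnA 2 (volume : Measure ℝ) := by
  rw [fnA_eq_indicator, memLp_indicator_iff_restrict measurableSet_Ioc,
    ← Measure.restrict_congr_set Ioo_ae_eq_Ioc]
  exact memLp_fnA

/-- **`L²`-continuity of the dilations of `A`**, uniformly on `(0,1]`: for `η > 0` there is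
`δ > 0` with `‖A(·/t) − A(·/τ)‖_{L²(0,1)} ≤ η` whenever `t, τ ∈ (0,1]`, `|t − τ| < δ`
(density of `C_c` in `L²`, uniform continuity, and `‖F(·/t)‖_{L²(0,1)} ≤ √t‖F‖_{L²(ℝ)}`).
[folklore] -/
private theorem dilate_fnA_uniform {η : ℝ} (hη : 0 < η) :
    ∃ δ > 0, ∀ t τ : ℝ, 0 < t → t ≤ 1 → 0 < τ → τ ≤ 1 → |t - τ| < δ →
      eLpNorm (fun u : ℝ ↦ fnA (u / t) - fnA (u / τ)) 2 (volume.restrict (Ioo (0 : ℝ) 1)) ≤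
        ENNReal.ofReal η := by
  have hA := memLp_fnA_volume
  have hNfin : eLpNorm fnA 2 volume ≠ ⊤ := hA.eLpNorm_ne_top
  set N : ℝ := (eLpNorm fnA 2 volume).toReal with hN
  have hN0 : 0 ≤ N := ENNReal.toReal_nonneg
  have hNeq : eLpNorm fnA 2 volume = ENNReal.ofReal N := (ENNReal.ofReal_toReal hNfin).symm
  obtain ⟨B, hBcs, hBle, hBcont, -⟩ := hA.exists_hasCompactSupport_eLpNorm_sub_le
    ENNReal.ofNat_ne_top (ε := ENNReal.ofReal (η / 4)) (by simpa using hη)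
  obtain ⟨δB, hδB, hδBε⟩ := Metric.uniformContinuous_iff.1
    (hBcs.uniformContinuous_of_continuous hBcont) (η / 4) (by positivity)
  set ρ : ℝ := η / (4 * (N + 1)) with hρ
  have hρ0 : 0 < ρ := by positivity
  set δ₀ : ℝ := ρ ^ 2 / 2 with hδ₀
  have hδ₀0 : 0 < δ₀ := by positivity
  refine ⟨min δ₀ (δB * δ₀ ^ 2 / 2), by positivity, ?_⟩
  intro t τ ht ht1 hτ hτ1 hd
  have hd0 : |t - τ| < δ₀ := lt_of_lt_of_le hd (min_le_left _ _)
  have hdB : |t - τ| < δB * δ₀ ^ 2 / 2 := lt_of_lt_of_le hd (min_le_right _ _)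
  have hmA : ∀ s : ℝ, AEStronglyMeasurable (fun u : ℝ ↦ fnA (u / s))
      (volume.restrict (Ioo (0 : ℝ) 1)) :=
    fun s ↦ (measurable_fnA.comp (measurable_id.div_const s)).aestronglyMeasurable
  have hmB : ∀ s : ℝ, AEStronglyMeasurable (fun u : ℝ ↦ B (u / s))
      (volume.restrict (Ioo (0 : ℝ) 1)) :=
    fun s ↦ (hBcont.measurable.comp (measurable_id.div_const s)).aestronglyMeasurable
  have hμ1 : (volume.restrict (Ioo (0 : ℝ) 1)) univ = 1 := by
    rw [Measure.restrict_apply_univ, Real.volume_Ioo]; simp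
  -- the dilation bound for a general `F`, `0 < s ≤ 1`
  have hdil : ∀ {F : ℝ → ℂ}, AEStronglyMeasurable F volume → ∀ {s : ℝ}, 0 < s → s ≤ 1 →
      eLpNorm (fun u : ℝ ↦ F (u / s)) 2 (volume.restrict (Ioo (0 : ℝ) 1)) ≤ eLpNorm F 2 volume := by
    intro F hF s hs hs1
    refine (eLpNorm_comp_div_le hF hs).trans ?_
    calc ENNReal.ofReal s ^ (1 / (2 : ℝ)) * eLpNorm F 2 volume ≤ 1 * eLpNorm F 2 volume := by
          gcongr
          exact ENNReal.rpow_le_one (ENNReal.ofReal_le_one.2 hs1) (by norm_num)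
      _ = eLpNorm F 2 volume := one_mul _
  by_cases hfar : δ₀ ≤ t ∧ δ₀ ≤ τ
  · -- far from `0`: go through `B`
    have hsplit : (fun u : ℝ ↦ fnA (u / t) - fnA (u / τ)) = fun u ↦
        ((fnA - B) (u / t) + (B (u / t) - B (u / τ))) - (fnA - B) (u / τ) := by
      funext u; simp only [Pi.sub_apply]; ring
    have hAB : AEStronglyMeasurable (fnA - B) volume :=
      measurable_fnA.aestronglyMeasurable.sub hBcont.aestronglyMeasurable
    have hmAB : ∀ s : ℝ, AEStronglyMeasurable (fun u : ℝ ↦ (fnA - B) (u / s))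
        (volume.restrict (Ioo (0 : ℝ) 1)) := fun s ↦ (hmA s).sub (hmB s)
    have hmid : eLpNorm (fun u : ℝ ↦ B (u / t) - B (u / τ)) 2 (volume.restrict (Ioo (0 : ℝ) 1)) ≤
        ENNReal.ofReal (η / 4) := by
      have hb := eLpNorm_le_of_ae_bound (p := 2) (μ := volume.restrict (Ioo (0 : ℝ) 1))
        (f := fun u : ℝ ↦ B (u / t) - B (u / τ)) (C := η / 4) (by
          filter_upwards [ae_restrict_mem measurableSet_Ioo] with u hu
          rw [← dist_eq_norm]
          refine (hδBε ?_).le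
          have e : u / t - u / τ = u * (τ - t) / (t * τ) := by
            field_simp
          rw [Real.dist_eq, e, abs_div, abs_mul, abs_of_pos hu.1, abs_of_pos (mul_pos ht hτ),
            abs_sub_comm]
          have h1 : u * |t - τ| / (t * τ) ≤ |t - τ| / (δ₀ * δ₀) := by
            rw [div_le_div_iff₀ (mul_pos ht hτ) (mul_pos hδ₀0 hδ₀0)]
            have h2 : δ₀ * δ₀ ≤ t * τ := mul_le_mul hfar.1 hfar.2 hδ₀0.le ht.le
            have h3 : u * |t - τ| ≤ |t - τ| := by nlinarith [abs_nonneg (t - τ), hu.2]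
            nlinarith [abs_nonneg (t - τ)]
          refine lt_of_le_of_lt h1 ?_
          rw [div_lt_iff₀ (mul_pos hδ₀0 hδ₀0)]
          nlinarith)
      simpa [hμ1] using hb
    rw [hsplit]
    calc eLpNorm (fun u ↦ ((fnA - B) (u / t) + (B (u / t) - B (u / τ))) - (fnA - B) (u / τ)) 2
          (volume.restrict (Ioo (0 : ℝ) 1))
        ≤ eLpNorm (fun u ↦ (fnA - B) (u / t) + (B (u / t) - B (u / τ))) 2
            (volume.restrict (Ioo (0 : ℝ) 1)) +
          eLpNorm (fun u ↦ (fnA - B) (u / τ)) 2 (volume.restrict (Ioo (0 : ℝ) 1)) :=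
          eLpNorm_sub_le ((hmAB t).add ((hmB t).sub (hmB τ))) (hmAB τ) (by norm_num)
      _ ≤ (eLpNorm (fun u ↦ (fnA - B) (u / t)) 2 (volume.restrict (Ioo (0 : ℝ) 1)) +
            eLpNorm (fun u ↦ B (u / t) - B (u / τ)) 2 (volume.restrict (Ioo (0 : ℝ) 1))) +
          eLpNorm (fun u ↦ (fnA - B) (u / τ)) 2 (volume.restrict (Ioo (0 : ℝ) 1)) := by
          gcongr
          exact eLpNorm_add_le (hmAB t) ((hmB t).sub (hmB τ)) (by norm_num)
      _ ≤ (ENNReal.ofReal (η / 4) + ENNReal.ofReal (η / 4)) + ENNReal.ofReal (η / 4) := by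
          gcongr
          · exact (hdil hAB ht ht1).trans hBle
          · exact (hdil hAB hτ hτ1).trans hBle
      _ ≤ ENNReal.ofReal η := by
          rw [← ENNReal.ofReal_add (by positivity) (by positivity),
            ← ENNReal.ofReal_add (by positivity) (by positivity)]
          exact ENNReal.ofReal_le_ofReal (by linarith)
  · -- near `0`: both `t, τ < 2δ₀ = ρ²`, and `‖A(·/s)‖ ≤ √s‖A‖`
    have hboth : t < ρ ^ 2 ∧ τ < ρ ^ 2 := by
      rw [not_and_or, not_le, not_le] at hfar
      have := abs_lt.1 hd0
      rcases hfar with h | h <;> constructor <;> nlinarith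
    have hsq : ∀ {s : ℝ}, 0 < s → s < ρ ^ 2 →
        eLpNorm (fun u : ℝ ↦ fnA (u / s)) 2 (volume.restrict (Ioo (0 : ℝ) 1)) ≤
          ENNReal.ofReal (ρ * N) := by
      intro s hs hsρ
      refine (eLpNorm_comp_div_le measurable_fnA.aestronglyMeasurable hs).trans ?_
      rw [hNeq, ENNReal.ofReal_rpow_of_nonneg hs.le (by norm_num), ← ENNReal.ofReal_mul
        (Real.rpow_nonneg hs.le _)]
      refine ENNReal.ofReal_le_ofReal (mul_le_mul_of_nonneg_right ?_ hN0)
      rw [← Real.sqrt_eq_rpow]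
      exact ((Real.sqrt_lt' hρ0).2 hsρ).le
    calc eLpNorm (fun u ↦ fnA (u / t) - fnA (u / τ)) 2 (volume.restrict (Ioo (0 : ℝ) 1))
        ≤ eLpNorm (fun u ↦ fnA (u / t)) 2 (volume.restrict (Ioo (0 : ℝ) 1)) +
            eLpNorm (fun u ↦ fnA (u / τ)) 2 (volume.restrict (Ioo (0 : ℝ) 1)) :=
          eLpNorm_sub_le (hmA t) (hmA τ) (by norm_num)
      _ ≤ ENNReal.ofReal (ρ * N) + ENNReal.ofReal (ρ * N) :=
          add_le_add (hsq ht hboth.1) (hsq hτ hboth.2)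
      _ ≤ ENNReal.ofReal η := by
          rw [← ENNReal.ofReal_add (by positivity) (by positivity)]
          refine ENNReal.ofReal_le_ofReal ?_
          have hρN : ρ * N ≤ η / 4 := by
            rw [hρ, div_mul_eq_mul_div, div_le_div_iff₀ (by positivity) (by positivity)]
            nlinarith [hN0, hη]
          linarith

/-! ## Stage 2, final step: `RH ⟹ span{U(λ)A : 0 < λ ≤ 1}` is dense in `L²(0,1)` -/

/-- Measurability of the two-variable kernel `(t,u) ↦ φ̃′(t)A(u/t) − φ̃′(τ_K t)A(u/τ_K t)`. [folklore] -/
private theorem measurable_gridKernel {Φ' : ℝ → ℂ} (hΦ' : Continuous Φ') (K : ℕ) :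
    Measurable (Function.uncurry fun t u : ℝ ↦
      Φ' t * fnA (u / t) - Φ' ((⌈(K : ℝ) * t⌉₊ : ℝ) / K) * fnA (u / ((⌈(K : ℝ) * t⌉₊ : ℝ) / K))) := by
  have hτ : Measurable (fun t : ℝ ↦ ((⌈(K : ℝ) * t⌉₊ : ℝ) / K)) :=
    ((measurable_from_nat (f := fun n : ℕ ↦ (n : ℝ))).comp
      (Nat.measurable_ceil.comp (measurable_const.mul measurable_id))).div_const _
  refine Measurable.sub ?_ ?_
  · exact (hΦ'.measurable.comp measurable_fst).mul
      (measurable_fnA.comp (measurable_snd.div measurable_fst))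
  · exact (hΦ'.measurable.comp (hτ.comp measurable_fst)).mul
      (measurable_fnA.comp (measurable_snd.div (hτ.comp measurable_fst)))

/-- The grid point `τ_K(t) = ⌈Kt⌉/K` lies in `(0,1]` and within `1/K` of `t ∈ (0,1]`. [folklore] -/
private theorem gridCeil_mem {K : ℕ} (hK : 0 < K) {t : ℝ} (ht : t ∈ Ioc (0 : ℝ) 1) :
    0 < ((⌈(K : ℝ) * t⌉₊ : ℝ) / K) ∧ ((⌈(K : ℝ) * t⌉₊ : ℝ) / K) ≤ 1 ∧
      |t - ((⌈(K : ℝ) * t⌉₊ : ℝ) / K)| < 1 / K := by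
  have hK0 : (0 : ℝ) < K := Nat.cast_pos.2 hK
  have hKt : 0 < (K : ℝ) * t := mul_pos hK0 ht.1
  have h1 : 1 ≤ ⌈(K : ℝ) * t⌉₊ := Nat.succ_le_of_lt (Nat.ceil_pos.2 hKt)
  have h2 : ⌈(K : ℝ) * t⌉₊ ≤ K := Nat.ceil_le.2 (by nlinarith [ht.2])
  have h3 : (K : ℝ) * t ≤ ⌈(K : ℝ) * t⌉₊ := Nat.le_ceil _
  have h4 : (⌈(K : ℝ) * t⌉₊ : ℝ) < K * t + 1 := Nat.ceil_lt_add_one hKt.le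
  refine ⟨by positivity, ?_, ?_⟩
  · rw [div_le_one hK0]; exact_mod_cast h2
  · rw [abs_sub_comm, abs_of_nonneg (by rw [sub_nonneg, le_div_iff₀ hK0, mul_comm]; exact h3),
      sub_lt_iff_lt_add, div_lt_iff₀ hK0, add_mul, one_div_mul_cancel hK0.ne']
    linarith [h4]

/-- **Burnol 2001, Thm 2.4 — the half `RH ⟹ span{U(λ)A : 0 < λ ≤ 1}` dense in `L²(0,1)`**, by
the elementary road of this file: under RH, `g ≈ T(ψ)` (`approxT_memLp`, Thm 2.6/2.7 machinery);
`T(ψ) = −∫_0^1 φ̃′(t)A(·/t)dt` exactly; the Riemann sums `K^{-1}Σ_j(−φ̃′(t_j))A(·/t_j)` are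
finite combinations of the dilates `U(t_j)A` and converge to `T(ψ)` in `L²(0,1)` (Cauchy–Schwarz
in `t`, Tonelli, uniform continuity of `φ̃′`, `L²`-continuity of `t ↦ A(·/t)`). Burnol's printed
road is the outer-function/Beurling–Lax argument; this is a stated deviation.
[cite: Burnol2001, Thm 2.4 (arXiv v3)] -/
theorem dilate_fnA_closure_of_riemannHypothesis (hRH : RiemannHypothesis) :
    ∀ g : ℝ → ℂ, MemLp g 2 (volume.restrict (Ioo (0 : ℝ) 1)) →
      ∀ ε : ℝ, 0 < ε → ∃ (n : ℕ) (lam : Fin n → ℝ) (c : Fin n → ℂ), (∀ i, 0 < lam i ∧ lam i ≤ 1) ∧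
        eLpNorm (fun u : ℝ ↦ g u - ∑ i, c i * dilate (lam i) fnA u) 2
          (volume.restrict (Ioo (0 : ℝ) 1)) < ENNReal.ofReal ε := by
  intro g hg ε hε
  obtain ⟨ψ, hψ, hgψ⟩ :=
    approxT_memLp (periodization_closure_of_riemannHypothesis hRH) hg (ε / 2) (by positivity)
  -- the derivative of `φ̃` and its bounds on `[0,1]`
  set Φ' : ℝ → ℂ :=
    deriv (fun y : ℝ ↦ ψ y + ψ (-y) - ∫ σ in (0 : ℝ)..1, (ψ (y * σ) + ψ (-(y * σ)))) with hΦ'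
  have hΦ'c : Continuous Φ' := hψ.continuous_deriv_tilde
  obtain ⟨M, hM⟩ := isCompact_Icc.exists_bound_of_continuousOn
    (hΦ'c.continuousOn (s := Icc (0 : ℝ) 1))
  have hM0 : 0 ≤ M := le_trans (norm_nonneg _) (hM 0 ⟨le_rfl, zero_le_one⟩)
  have hA := memLp_fnA_volume
  have hNAfin : eLpNorm fnA 2 volume ≠ ⊤ := hA.eLpNorm_ne_top
  set N : ℝ := (eLpNorm fnA 2 volume).toReal with hN
  have hN0 : 0 ≤ N := ENNReal.toReal_nonneg
  have hNeq : eLpNorm fnA 2 volume = ENNReal.ofReal N := (ENNReal.ofReal_toReal hNAfin).symm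
  -- tolerances
  obtain ⟨δA, hδA, hδAη⟩ := dilate_fnA_uniform (η := ε / (4 * (M + 1))) (by positivity)
  obtain ⟨δΦ, hδΦ, hδΦε⟩ := Metric.uniformContinuousOn_iff.1
    (isCompact_Icc.uniformContinuousOn_of_continuous hΦ'c.continuousOn)
    (ε / (4 * (N + 1))) (by positivity)
  obtain ⟨K, hK⟩ : ∃ K : ℕ, 1 / min δA δΦ < K := exists_nat_gt _
  have hK0r : 0 < (K : ℝ) := lt_trans (by positivity) hK
  have hK0 : 0 < K := Nat.cast_pos.1 hK0r
  have hKδ : 1 / (K : ℝ) < min δA δΦ := by rw [div_lt_comm₀ hK0r (by positivity)]; exact hK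
  -- the approximant
  refine ⟨K, fun i ↦ (((i : ℕ) + 1 : ℕ) : ℝ) / K,
    fun i ↦ -((K : ℂ)⁻¹ * Φ' ((((i : ℕ) + 1 : ℕ) : ℝ) / K)) /
      (Real.sqrt (1 / ((((i : ℕ) + 1 : ℕ) : ℝ) / K)) : ℂ), fun i ↦ ⟨by positivity, ?_⟩, ?_⟩
  · rw [div_le_one hK0r]; exact_mod_cast i.2
  -- identify the finite sum with the Riemann sum of `mapT_sub_gridSum_eq`
  have hsum : ∀ u : ℝ, ∑ i : Fin K, -((K : ℂ)⁻¹ * Φ' ((((i : ℕ) + 1 : ℕ) : ℝ) / K)) /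
        (Real.sqrt (1 / ((((i : ℕ) + 1 : ℕ) : ℝ) / K)) : ℂ) *
          dilate ((((i : ℕ) + 1 : ℕ) : ℝ) / K) fnA u =
      (K : ℂ)⁻¹ * ∑ j ∈ Finset.range K,
        -(Φ' (((j + 1 : ℕ) : ℝ) / K) * fnA (u / (((j + 1 : ℕ) : ℝ) / K))) := by
    intro u
    rw [Finset.mul_sum, Finset.sum_range]
    refine Finset.sum_congr rfl fun i _ ↦ ?_
    have hl : 0 < (((i : ℕ) + 1 : ℕ) : ℝ) / K := by positivity
    have hs : (Real.sqrt (1 / ((((i : ℕ) + 1 : ℕ) : ℝ) / K)) : ℂ) ≠ 0 := by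
      exact_mod_cast (Real.sqrt_pos.2 (by positivity)).ne'
    have hKc : (K : ℂ) ≠ 0 := by exact_mod_cast hK0r.ne'
    simp only [dilate]
    generalize (Real.sqrt (1 / ((((i : ℕ) + 1 : ℕ) : ℝ) / K)) : ℂ) = s at hs ⊢
    field_simp
  -- the `L²` estimate of `T(ψ) − Riemann sum`
  have hC : ∀ t ∈ Ioc (0 : ℝ) 1, eLpNorm (fun u : ℝ ↦
      Φ' t * fnA (u / t) - Φ' ((⌈(K : ℝ) * t⌉₊ : ℝ) / K) * fnA (u / ((⌈(K : ℝ) * t⌉₊ : ℝ) / K))) 2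
        (volume.restrict (Ioo (0 : ℝ) 1)) ≤ ENNReal.ofReal (ε / 2) := by
    intro t ht
    obtain ⟨hτ0, hτ1, hdist⟩ := gridCeil_mem hK0 ht
    set τ : ℝ := ((⌈(K : ℝ) * t⌉₊ : ℝ) / K) with hτ
    have hmA : ∀ s : ℝ, AEStronglyMeasurable (fun u : ℝ ↦ fnA (u / s))
        (volume.restrict (Ioo (0 : ℝ) 1)) :=
      fun s ↦ (measurable_fnA.comp (measurable_id.div_const s)).aestronglyMeasurable
    have hsplit : (fun u : ℝ ↦ Φ' t * fnA (u / t) - Φ' τ * fnA (u / τ)) =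
        fun u ↦ ((Φ' t - Φ' τ) • fun u ↦ fnA (u / t)) u +
          (Φ' τ • fun u ↦ fnA (u / t) - fnA (u / τ)) u := by
      funext u; simp only [Pi.smul_apply, smul_eq_mul]; ring
    rw [hsplit]
    have h1 : eLpNorm ((Φ' t - Φ' τ) • fun u ↦ fnA (u / t)) 2 (volume.restrict (Ioo (0 : ℝ) 1)) ≤
        ENNReal.ofReal (ε / 4) := by
      rw [eLpNorm_const_smul]
      have hd : ‖Φ' t - Φ' τ‖ ≤ ε / (4 * (N + 1)) := by
        rw [← dist_eq_norm]
        refine (hδΦε t ⟨ht.1.le, ht.2⟩ τ ⟨hτ0.le, hτ1⟩ ?_).le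
        rw [Real.dist_eq]
        exact hdist.trans (hKδ.trans_le (min_le_right _ _))
      have hn : eLpNorm (fun u ↦ fnA (u / t)) 2 (volume.restrict (Ioo (0 : ℝ) 1)) ≤
          ENNReal.ofReal N := by
        refine (eLpNorm_comp_div_le measurable_fnA.aestronglyMeasurable ht.1).trans ?_
        rw [hNeq]
        calc ENNReal.ofReal t ^ (1 / (2 : ℝ)) * ENNReal.ofReal N ≤ 1 * ENNReal.ofReal N := by
              gcongr
              exact ENNReal.rpow_le_one (ENNReal.ofReal_le_one.2 ht.2) (by norm_num)
          _ = ENNReal.ofReal N := one_mul _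
      calc ‖Φ' t - Φ' τ‖ₑ * eLpNorm (fun u ↦ fnA (u / t)) 2 (volume.restrict (Ioo (0 : ℝ) 1))
          ≤ ENNReal.ofReal (ε / (4 * (N + 1))) * ENNReal.ofReal N := by
            rw [← ofReal_norm]
            exact mul_le_mul' (ENNReal.ofReal_le_ofReal hd) hn
        _ = ENNReal.ofReal (ε / (4 * (N + 1)) * N) := by rw [ENNReal.ofReal_mul (by positivity)]
        _ ≤ ENNReal.ofReal (ε / 4) := by
            refine ENNReal.ofReal_le_ofReal ?_
            rw [div_mul_eq_mul_div, div_le_div_iff₀ (by positivity) (by positivity)]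
            nlinarith
    have h2 : eLpNorm (Φ' τ • fun u ↦ fnA (u / t) - fnA (u / τ)) 2 (volume.restrict (Ioo (0 : ℝ) 1)) ≤
        ENNReal.ofReal (ε / 4) := by
      rw [eLpNorm_const_smul]
      have hd : eLpNorm (fun u ↦ fnA (u / t) - fnA (u / τ)) 2 (volume.restrict (Ioo (0 : ℝ) 1)) ≤
          ENNReal.ofReal (ε / (4 * (M + 1))) :=
        hδAη t τ ht.1 ht.2 hτ0 hτ1 (hdist.trans (hKδ.trans_le (min_le_left _ _)))
      have hm : ‖Φ' τ‖ ≤ M := hM τ ⟨hτ0.le, hτ1⟩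
      calc ‖Φ' τ‖ₑ * eLpNorm (fun u ↦ fnA (u / t) - fnA (u / τ)) 2 (volume.restrict (Ioo (0 : ℝ) 1))
          ≤ ENNReal.ofReal M * ENNReal.ofReal (ε / (4 * (M + 1))) := by
            rw [← ofReal_norm]
            exact mul_le_mul' (ENNReal.ofReal_le_ofReal hm) hd
        _ = ENNReal.ofReal (M * (ε / (4 * (M + 1)))) := by rw [ENNReal.ofReal_mul hM0]
        _ ≤ ENNReal.ofReal (ε / 4) := by
            refine ENNReal.ofReal_le_ofReal ?_
            rw [mul_div_assoc', div_le_div_iff₀ (by positivity) (by positivity)]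
            nlinarith
    calc eLpNorm (fun u ↦ ((Φ' t - Φ' τ) • fun u ↦ fnA (u / t)) u +
          (Φ' τ • fun u ↦ fnA (u / t) - fnA (u / τ)) u) 2 (volume.restrict (Ioo (0 : ℝ) 1))
        ≤ eLpNorm ((Φ' t - Φ' τ) • fun u ↦ fnA (u / t)) 2 (volume.restrict (Ioo (0 : ℝ) 1)) +
          eLpNorm (Φ' τ • fun u ↦ fnA (u / t) - fnA (u / τ)) 2 (volume.restrict (Ioo (0 : ℝ) 1)) :=
          eLpNorm_add_le ((hmA t).const_smul _) (((hmA t).sub (hmA τ)).const_smul _) (by norm_num)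
      _ ≤ ENNReal.ofReal (ε / 4) + ENNReal.ofReal (ε / 4) := add_le_add h1 h2
      _ = ENNReal.ofReal (ε / 2) := by
          rw [← ENNReal.ofReal_add (by positivity) (by positivity)]; ring_nf
  have hint := eLpNorm_intervalIntegral_le (measurable_gridKernel hΦ'c K) hC
  -- `T(ψ) − R_K` in `L²(0,1)`
  have hTR : eLpNorm (fun u : ℝ ↦ mapT ψ u - (K : ℂ)⁻¹ * ∑ j ∈ Finset.range K,
        -(Φ' (((j + 1 : ℕ) : ℝ) / K) * fnA (u / (((j + 1 : ℕ) : ℝ) / K)))) 2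
        (volume.restrict (Ioo (0 : ℝ) 1)) ≤ ENNReal.ofReal (ε / 2) := by
    have hae : (fun u : ℝ ↦ mapT ψ u - (K : ℂ)⁻¹ * ∑ j ∈ Finset.range K,
        -(Φ' (((j + 1 : ℕ) : ℝ) / K) * fnA (u / (((j + 1 : ℕ) : ℝ) / K))))
        =ᵐ[volume.restrict (Ioo (0 : ℝ) 1)] -(fun u ↦ ∫ t in (0 : ℝ)..1,
          (Φ' t * fnA (u / t) - Φ' ((⌈(K : ℝ) * t⌉₊ : ℝ) / K) * fnA (u / ((⌈(K : ℝ) * t⌉₊ : ℝ) / K)))) := by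
      filter_upwards [ae_restrict_mem measurableSet_Ioo] with u hu
      simp only [Pi.neg_apply]
      exact hψ.mapT_sub_gridSum_eq hu.1 hK0
    rw [eLpNorm_congr_ae hae, eLpNorm_neg]
    exact hint
  -- conclusion
  have hmR : AEStronglyMeasurable (fun u : ℝ ↦ (K : ℂ)⁻¹ * ∑ j ∈ Finset.range K,
      -(Φ' (((j + 1 : ℕ) : ℝ) / K) * fnA (u / (((j + 1 : ℕ) : ℝ) / K))))
      (volume.restrict (Ioo (0 : ℝ) 1)) := by
    refine (Finset.aestronglyMeasurable_fun_sum _ fun j _ ↦ ?_).const_mul _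
    exact ((measurable_fnA.comp (measurable_id.div_const _)).const_mul _).neg.aestronglyMeasurable
  have hfun : (fun u : ℝ ↦ g u - ∑ i : Fin K, -((K : ℂ)⁻¹ * Φ' ((((i : ℕ) + 1 : ℕ) : ℝ) / K)) /
        (Real.sqrt (1 / ((((i : ℕ) + 1 : ℕ) : ℝ) / K)) : ℂ) *
          dilate ((((i : ℕ) + 1 : ℕ) : ℝ) / K) fnA u) =
      fun u ↦ (g u - mapT ψ u) + (mapT ψ u - (K : ℂ)⁻¹ * ∑ j ∈ Finset.range K,
        -(Φ' (((j + 1 : ℕ) : ℝ) / K) * fnA (u / (((j + 1 : ℕ) : ℝ) / K)))) := by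
    funext u; rw [hsum u]; ring
  rw [hfun]
  calc eLpNorm (fun u ↦ (g u - mapT ψ u) + (mapT ψ u - (K : ℂ)⁻¹ * ∑ j ∈ Finset.range K,
          -(Φ' (((j + 1 : ℕ) : ℝ) / K) * fnA (u / (((j + 1 : ℕ) : ℝ) / K))))) 2
          (volume.restrict (Ioo (0 : ℝ) 1))
      ≤ eLpNorm (fun u ↦ g u - mapT ψ u) 2 (volume.restrict (Ioo (0 : ℝ) 1)) +
          eLpNorm (fun u ↦ mapT ψ u - (K : ℂ)⁻¹ * ∑ j ∈ Finset.range K,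
            -(Φ' (((j + 1 : ℕ) : ℝ) / K) * fnA (u / (((j + 1 : ℕ) : ℝ) / K)))) 2
            (volume.restrict (Ioo (0 : ℝ) 1)) :=
        eLpNorm_add_le (hg.1.sub hψ.aestronglyMeasurable_mapT_Ioo)
          (hψ.aestronglyMeasurable_mapT_Ioo.sub hmR) (by norm_num)
    _ < ENNReal.ofReal (ε / 2) + ENNReal.ofReal (ε / 2) :=
        ENNReal.add_lt_add_of_lt_of_le (ne_top_of_le_ne_top ENNReal.ofReal_ne_top hTR) hgψ hTR
    _ = ENNReal.ofReal ε := by rw [← ENNReal.ofReal_add (by positivity) (by positivity)]; ring_nf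

end Burnol2001

/-- DISCHARGE of the named fact **Burnol 2001, Thm 2.4 (typed clause)**: RH holds iff the dilates
`U(λ)A`, `0 < λ ≤ 1`, span `L²(0,1)` — proved AS AN EQUIVALENCE (neither side asserted):
`⟹` is `Burnol2001.dilate_fnA_closure_of_riemannHypothesis` (elementary road above),
`⟸` is the tree theorem `riemannHypothesis_of_dilate_fnA_closure` (Burnol's printed Mellin
computation `Â(s) = (s−1)ζ(s)/s²`, p436464). [cite: Burnol2001, Thm 2.4 (arXiv v3)] -/
theorem Burnol2001_thm_2_4_holds : Burnol2001_thm_2_4 :=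
  ⟨Burnol2001.dilate_fnA_closure_of_riemannHypothesis, riemannHypothesis_of_dilate_fnA_closure⟩

namespace Burnol2001

end Burnol2001

end Literature.NumberTheory.LFunctions

end
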